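import Literature.MathematicalPhysics.QuantumFieldTheory.Balaban1983to89.B9Cor36CinvCubeLocDefectCore

/-!
# `Balaban1983to89.B9Cor36CinvCubeLocDefectCoreHom` — THE CUBE-SIDE LOCALIZED DEFECT CORE `1_S·D_□·1_S` OF p21's (3.95) FOURTH SUM, PERTURBATIVE-`Q′_□` EDITION:
# FILE E2-3b-ii's block majorant with the transporter hypothesis `hpar` at `Ṽ_□` replaced by the two block-local two-space majorants of `conjHom b(Q′_□(Ṽ)|_ℝ)`,
# `conjHom b(Q′_□*(Ṽ)|_ℝ)` — so that print's (3.57)–(3.59) perturbation of the averaging operators (currency A, no unitarity of the localised field) feeds it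
# (sub-row G-B9-LETTERS, module M5.2-E, FILE E2-5b-1; design (β) of `lit-balaban-p21/M52E-DESIGN-p21.md`)

T. Bałaban, *Propagators for lattice gauge theories in a background field*, Commun. Math. Phys. **99** (1985) 389–434
[`Balaban1985BackgroundPropagators`, "B9"]; [4] = T. Bałaban, *Propagators and renormalization transformations for lattice gauge
theories. II*, Commun. Math. Phys. **96** (1984) 223–250 [`Balaban1984PropagatorsII`].

statement-level skeleton of published theorems with citation tags; proofs where landed; nothing here is a claim about the
Yang–Mills mass gap

THE PRINTED LOCUS (verbatim, held `paper:balaban1985-cmp99-background-propagators`, journal page = PDF page + 388).  (3.95) p. 411; p. 412 l. 31–36 (the C-part *«can be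
estimated by O(1)M^{−4}R^{d}_{n+1}exp(−δM)»* — smallness by SEPARATION); (3.57) p. 401 *«Q′(U′U) = Q′(U) + F′₂(U′, U), Q′\*(U′U) = Q′\*(U) + F′₂\*(U′, U)»*, (3.59) p. 402
(*«|F′₂λ| ≦ O(1)α₁Q̃′|λ|»*); Cor. 3.6 p. 408 l. 3–9 (*«U′ = U^u = e^{iηA} … U′ satisfies (3.37) for the sequence {Ω′_j} with U = 1 and α₁ = O(1)Mα₀»*); [4] (2.82)–(2.85)
pp. 237–238, (2.51)–(2.55) p. 232, Lemma 2.1 (2.61) p. 234; Thm 3.1 (3.42) p. 397, Thm 3.2 (3.48) p. 398, p. 409 l. 2–5.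

WHY THIS FILE.  FILE E2-3b-ii (`B9Cor36CinvCubeLocDefectCore.hasMajorant_conj_locDefectCore`) majorises the localized defect core through FILE E2-4a's `Q′_□(Ṽ)( · )Q′_□*(Ṽ)`
sandwich AT THE LOCALISED FIELD, whose block-locality constants `M₂Σ‖b‖` presuppose bi-contractive transporters of `Ṽ_□ = e^{iηχ̃_□A}·1` (`hpar`).  In the tree's abstract
normed algebra `𝔸` the (3.35) datum (`B9Eq335RegularityClasses.Reg335Cube`: a bi-contractive gauge `u` and a potential `A` with `U^u = e^{iηA}` on the cube's bonds) does NOT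
make `e^{iηχ̃_□A}` unitary-like, so `hpar` at `Ṽ_□` is not dischargeable from the datum.  Print never needs it: (3.57)–(3.59) treat `Q′(U′U)` as `Q′(U)` plus a
perturbation of size `O(1)α₁`, and r05's CURRENCY-A lemmas (`B9Eq357CubeLetters.norm_QpCubeY_prod_sub_apply_le ∕ norm_QpsCubeY_prod_sub_apply_le`) give these sizes at
`Ṽ_□` from the blockwise (3.37) smallness of `χ̃_□A` alone.  THIS FILE re-runs E2-3b-ii's §2 with the two uses of `hpar` replaced by E2-4a's GENERIC sandwich
(`B9Cor36CubeSandwichQ.hasMajorant_conj_cube_sandwich`, constants `κ₁ = κ₂ = κ_Q`) fed by two-space majorant HYPOTHESES `hQ`, `hQs` (supplied at the datum by FILE E2-5b-3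
with `κ_Q = M₂Σ‖b‖·(1 + C_q·α₁)`): ★★★ `hasMajorant_conj_locDefectCore_of_hom` — E2-3b-ii's conclusion with `(M₂Σ‖b‖)²` replaced by `κ_Q²`.

HONEST SCOPE.  Bookkeeping + [4] §2 majorant algebra over DEFINED objects; every analytic input is a displayed hypothesis (suppliers: `hG` p33 `B9Cor36GpCubeExtAtV.hasMajorant_GpVK`,
`hC` p21 E2-4d `cor35_Cinv_cube`, `hQ`∕`hQs` FILE E2-5b-3, geometry p33 5a, separations FILE E2-5b-2).  Count-neutral; no summit ∕ sub-problem statement is proved; nothing continuum ∕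
OS ∕ mass-gap ∕ Clay.  No `sorry`, no `axiom`, no `… : Prop` fact, no `instance`, no `notation`, no `def`.  NEW file; nothing landed is modified (E2-3b-ii kept verbatim for its
consumers).  Cell `lit-balaban`, seat `lit-balaban-p21` gen 35, 2026-08-28; `--supports stmt-QuantumFields-19200` as helper.  Net new unproved facts: 0.

RELATED IN THE TREE, NOT DUPLICATED (searched 2026-08-28: `lean search 'locDefectCore' --decl` = E2-3b-ii's three decls only): p21 E2-3b-ii `B9Cor36CinvCubeLocDefectCore` (§1 algebra
`conj_locDefectCore_eq`, `hasMajorant_mul_mulOp`, `mulOp_const_one`, `len_sq_sq_rpow_neg4` USED BY NAME; its §2 is the `hpar` edition), E2-3b-i `B9Thm39CinvSepMiddle` (engine),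
E2-4a `B9Cor36CubeSandwichQ` (generic sandwich, `smul_XCubeY_restrictScalars`), E2-4c `B9Eq357CubeQpDiffMajorant` (the perturbation majorants, consumed by FILE E2-5b-3, not here);
r05 `B9Eq357CubeLetters`; p33 `B9CubeGeometryInputs` — no existing module modified.
-/

noncomputable section

namespace Literature.MathematicalPhysics.QuantumFieldTheory.Balaban1983to89.B9Cor36CinvCubeLocDefectCoreHom

open B6KLevelCensusIndexV1 (KIdx kGeo)
open B6Cover236MultiLevelBlocks (cubes)
open B6Geom246MultiLevelBoxL0 (blkOf)
open B6RandomWalk (HasMajorant BlockSupp hasMajorant_mono hasMajorant_add Triangle254 Ineq261 c1_nonneg)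
open B6RandomWalkHom (HasMajorantHom)
open B9Thm34Ext (toB6)
open B9Eq352DivFormLetters (conj)
open B9Eq376POneLetters (conjHom)
open B9Thm37Sum (mulOp mulOp_apply)
open B9Thm39CinvTorusRegular (conj_cutMulY conj_add)
open B9Thm39CinvSepMiddle (sepMiddle_majorant_blk)
open B9CubeLettersOpsL0 (cubeFamY GpCubeY)
open B9CubeLettersBondOpsL0 (BlkCubeY QpCubeY QpsCubeY XCubeY XinvCubeY)
open B9Eq360DeltaPrimeACubeY (blkCubeY blkCubeY_apply)
open B9Cor36CinvCubeLocLetter (cubeBlkInd cubeBlkInd_apply cinvDefectCoreY)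
open B9Cor36CubeSandwichQ (hasMajorant_conj_cube_sandwich smul_XCubeY_restrictScalars)
open B9Cor36CinvCubeLocDefectCore (conj_locDefectCore_eq hasMajorant_mul_mulOp mulOp_const_one len_sq_sq_rpow_neg4)
open B9CubeGeometryInputs (geoCK geoCK_len_pos)
open B9Cor35GpCubeInputsAtOne (eta_ne_zero)
open B9Thm37CubeCoverCommutators (cutMulY cutMulY_apply)
open Node00 (SiteY CfgY SiteParY toKT)

variable {d ℓ : ℕ} {hd : 1 ≤ d + 1} {hL : Odd (ℓ + 1) ∧ 1 < ℓ + 1} {b₀ b₁ : ℝ}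
variable {𝔸 : Type} [NormedRing 𝔸] [NormedAlgebra ℂ 𝔸] [CompleteSpace 𝔸] {ι : Type} [Fintype ι] (b : Module.Basis ι ℝ 𝔸)
variable (i : KIdx d ℓ hd hL b₀ b₁) (c : ↥(cubes (toKT i).D.toDomains)) (parS : SiteParY 𝔸 i)

/-! ## ★★★ The block majorant of the localized defect core from two-space majorants of `Q′_□(Ṽ)`, `Q′_□*(Ṽ)` -/

/-- ★★★ **THE BLOCK MAJORANT OF THE LOCALIZED DEFECT CORE `1_S·D_□·1_S`, PERTURBATIVE `Q′_□` EDITION** over `(toB6 (geoCK i □) Rr Hp, Prod.fst)` — FILE E2-3b-ii's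
`hasMajorant_conj_locDefectCore` with the bi-contractive-transporter hypothesis `hpar` REPLACED by the two block-local two-space majorants `hQ`, `hQs` of
`conjHom b(Q′_□(Ṽ)|_ℝ)`, `conjHom b(Q′_□*(Ṽ)|_ℝ)` with a common diagonal constant `κ_Q ≧ 0` (supplied at the localised field `Ṽ_□ = e^{iηχ̃_□A}·1` by print's (3.57)–(3.59)
perturbation `Q′(U′U) = Q′(U) + F′₂`, `|F′₂λ| ≦ O(1)α₁Q̃′|λ|` in currency A — r05's `B9Eq357CubeLetters.norm_QpCubeY_prod_sub_apply_le` — WITHOUT any unitarity of `Ṽ_□`):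
from the site-level (3.42)₁ majorant `hG` of `conj b(η²G′_□(Ṽ))`, the block-level (3.48) majorant `hC` of `conj b(η⁻⁴C_□(Ṽ))`, (2.54), (2.61) at the exponents `1/10, 3/5, 3/4`,
the scale transfers of `ℓ²`, `ℓ^{−4}` at `1/10`, a cut-off `0 ≦ χ ≦ 1` equal to `1` on the blocks outside `Z_χ`, and the separations `D_N ≦ d(S, ∁N)`, `D_χ ≦ d(S, Z_χ)`:
  `conj b((1_S·D_□·1_S)|_ℝ) ≺ 𝟙_S(a)·(κ_A·e^{−(2/5)δ₀D_N} + κ_B·e^{−(2/5)δ₀D_χ})·e^{−(1/4)δ₀d(a,a′)}`,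
`κ_A = κ_Q²B_G²Λc₁(1/10)·B_CΛc₁(3/5)`, `κ_B = κ_Q²B_G²Λc₁(3/5)·B_CΛc₁(3/4)` — three uses of [4] (2.83) with the separation in the middle (FILE E2-3b-i), FILE E2-4a's GENERIC
`Q_r( · )Q_{sr}` sandwich (`hasMajorant_conj_cube_sandwich`), and FILE E2-3b-ii §1. [cite: Balaban1985BackgroundPropagators, (3.95) p.411, p.412 l.31–36, (3.57) p.401, (3.59) p.402, Thm 3.1 (3.42) p.397, Thm 3.2 (3.48) p.398; Balaban1984PropagatorsII, (2.82)–(2.85) pp.237–238, Lemma 2.1 (2.61) p.234, (2.51)–(2.55) p.232] -/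
theorem hasMajorant_conj_locDefectCore_of_hom (V : CfgY 𝔸 i) {Rr : ℝ} {Hp : Prop} {κQ : ℝ} (hκQ : 0 ≤ κQ)
    (hQ : HasMajorantHom (g := toB6 (geoCK i c) Rr Hp) (fun p : SiteY i × ι => blkCubeY i c p.1) (fun q : BlkCubeY i c × ι => q.1)
      (conjHom b ((QpCubeY i c parS V).restrictScalars ℝ)) (fun a a' : BlkCubeY i c => if a = a' then κQ else 0))
    (hQs : HasMajorantHom (g := toB6 (geoCK i c) Rr Hp) (fun q : BlkCubeY i c × ι => q.1) (fun p : SiteY i × ι => blkCubeY i c p.1)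
      (conjHom b ((QpsCubeY i c parS V).restrictScalars ℝ)) (fun a a' : BlkCubeY i c => if a = a' then κQ else 0))
    (hdnn : ∀ a a' : BlkCubeY i c, 0 ≤ (geoCK i c).dist a a') (htri : Triangle254 (toB6 (geoCK i c) Rr Hp))
    (hsymm : ∀ a a' : BlkCubeY i c, (geoCK i c).dist a a' = (geoCK i c).dist a' a)
    (dB : ℕ) {δ₀ Λ BG BC : ℝ} (hδ₀ : 0 ≤ δ₀) (hΛ : 0 ≤ Λ) (hBG : 0 ≤ BG) (hBC : 0 ≤ BC)
    (h261a : Ineq261 dB (toB6 (geoCK i c) Rr Hp) δ₀ (1 - 9 / 10)) (h261b : Ineq261 dB (toB6 (geoCK i c) Rr Hp) δ₀ (1 - 2 / 5))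
    (h261c : Ineq261 dB (toB6 (geoCK i c) Rr Hp) δ₀ (1 - 1 / 4))
    (hST2 : B9Ineq347.ScaleTransfer (geoCK i c) δ₀ (1 / 10) Λ (fun a => (geoCK i c).len a ^ 2))
    (hST4 : B9Ineq347.ScaleTransfer (geoCK i c) δ₀ (1 / 10) Λ (fun a => (geoCK i c).len a ^ (-(4 : ℝ))))
    (χ : SiteY i → ℝ) (hχ0 : ∀ z, 0 ≤ χ z) (hχ1 : ∀ z, χ z ≤ 1) (Zχ : Finset (BlkCubeY i c)) (hχZ : ∀ z, blkCubeY i c z ∉ Zχ → χ z = 1)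
    (N S : Finset (BlkCubeY i c)) {DN Dχ : ℝ} (hDN : ∀ a ∈ S, ∀ y, y ∉ N → DN ≤ (geoCK i c).dist a y) (hDχ : ∀ a ∈ S, ∀ y ∈ Zχ, Dχ ≤ (geoCK i c).dist a y)
    (hG : HasMajorant (g := toB6 (geoCK i c) Rr Hp) (fun p : SiteY i × ι => blkCubeY i c p.1)
      (conj b (((kGeo i).eta ^ 2) • (GpCubeY i c parS V).restrictScalars ℝ))
      (fun a a' => BG * (geoCK i c).len a ^ 2 * Real.exp (-(δ₀ * (geoCK i c).dist a a'))))
    (hC : HasMajorant (g := toB6 (geoCK i c) Rr Hp) (fun q : BlkCubeY i c × ι => q.1)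
      (conj b ((((kGeo i).eta ^ 4)⁻¹) • (XinvCubeY i c parS V).restrictScalars ℝ))
      (fun a a' => BC * (geoCK i c).len a ^ (-(4 : ℝ)) * Real.exp (-(δ₀ * (geoCK i c).dist a a')))) :
    HasMajorant (g := toB6 (geoCK i c) Rr Hp) (fun q : BlkCubeY i c × ι => q.1)
      (conj b ((cutMulY (𝔸 := 𝔸) (cubeBlkInd i c S)).restrictScalars ℝ ∘ₗ (cinvDefectCoreY i c parS χ V N).restrictScalars ℝ ∘ₗ
        (cutMulY (𝔸 := 𝔸) (cubeBlkInd i c S)).restrictScalars ℝ))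
      (fun a a' : (geoCK i c).Site => (if a ∈ S then (1 : ℝ) else 0) *
        ((κQ * κQ) * (BG * BG * Λ * B6.c1 dB δ₀ (1 - 9 / 10)) * (BC * Λ * B6.c1 dB δ₀ (1 - 2 / 5)) * Real.exp (-(2 / 5 * δ₀ * DN)) +
          (κQ * κQ) * (BG * BG * Λ * B6.c1 dB δ₀ (1 - 2 / 5)) * (BC * Λ * B6.c1 dB δ₀ (1 - 1 / 4)) * Real.exp (-(2 / 5 * δ₀ * Dχ))) *
        Real.exp (-(1 / 4 * δ₀ * (geoCK i c).dist a a'))) := by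
  have hη4 : ((kGeo i).eta ^ 4 : ℝ) ≠ 0 := pow_ne_zero 4 (eta_ne_zero i)
  have hc1a : 0 ≤ B6.c1 dB δ₀ (1 - 9 / 10) := c1_nonneg _ _ _
  have hc1b : 0 ≤ B6.c1 dB δ₀ (1 - 2 / 5) := c1_nonneg _ _ _
  have hκQ2 : 0 ≤ κQ * κQ := mul_nonneg hκQ hκQ
  have hκX : 0 ≤ (κQ * κQ) * (BG * BG * Λ * B6.c1 dB δ₀ (1 - 9 / 10)) :=
    mul_nonneg hκQ2 (mul_nonneg (mul_nonneg (mul_nonneg hBG hBG) hΛ) hc1a)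
  have hℓ2 : ∀ a : BlkCubeY i c, 0 ≤ (geoCK i c).len a ^ 2 := fun a => sq_nonneg _
  have hℓ4 : ∀ a : BlkCubeY i c, 0 ≤ (geoCK i c).len a ^ (-(4 : ℝ)) := fun a => Real.rpow_nonneg (geoCK_len_pos i c a).le _
  have hind1 : ∀ (T : Finset (BlkCubeY i c)) (s : BlkCubeY i c), |cubeBlkInd i c T s| ≤ 1 := fun T s => by
    rw [cubeBlkInd_apply]; split_ifs <;> norm_num
  have hind1' : ∀ (T : Finset (BlkCubeY i c)) (s : BlkCubeY i c), |1 - cubeBlkInd i c T s| ≤ 1 := fun T s => by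
    rw [cubeBlkInd_apply]; split_ifs <;> norm_num
  -- the two inputs in the `a_L = b = 1` shape of FILE E2-3b-i
  have hG1 : HasMajorant (g := toB6 (geoCK i c) Rr Hp) (fun p : SiteY i × ι => blkCubeY i c p.1)
      (conj b (((kGeo i).eta ^ 2) • (GpCubeY i c parS V).restrictScalars ℝ))
      (fun a a' => BG * (geoCK i c).len a ^ 2 * Real.exp (-(1 * δ₀ * (geoCK i c).dist a a'))) :=
    hasMajorant_mono (g := toB6 (geoCK i c) Rr Hp) _ hG fun a a' => by rw [one_mul]
  have hC1 : HasMajorant (g := toB6 (geoCK i c) Rr Hp) (fun q : BlkCubeY i c × ι => q.1)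
      (conj b ((((kGeo i).eta ^ 4)⁻¹) • (XinvCubeY i c parS V).restrictScalars ℝ))
      (fun a a' => BC * (geoCK i c).len a ^ (-(4 : ℝ)) * Real.exp (-(1 * δ₀ * (geoCK i c).dist a a'))) :=
    hasMajorant_mono (g := toB6 (geoCK i c) Rr Hp) _ hC fun a a' => by rw [one_mul]
  -- STAGE G: `conj b(η²G′)·conj b(η²G′) ≺ B_G²Λc₁(1/10)·ℓ⁴·e^{−(9/10)δ₀d}` at the site level ((2.83) with trivial cut-offs)
  have hGG₀ := sepMiddle_majorant_blk (R := Rr) (H := Hp) (fun p : SiteY i × ι => blkCubeY i c p.1) dB δ₀ 1 (1 / 10) 0 (9 / 10) 1 BG BG Λ 0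
    (fun a => (geoCK i c).len a ^ 2) (fun a => (geoCK i c).len a ^ 2) (fun a => (geoCK i c).len a ^ 2) Finset.univ Finset.univ
    (fun _ => (1 : ℝ)) (fun _ => (1 : ℝ)) hBG hBG hΛ hℓ2 hℓ2 hℓ2 hδ₀ le_rfl (by norm_num) (by norm_num) htri hsymm hdnn hST2 h261a
    (fun _ => by norm_num) (fun _ h => absurd (Finset.mem_univ _) h) (fun _ => by norm_num) (fun _ h => absurd (Finset.mem_univ _) h)
    (fun a _ y _ => hdnn a y) hG1 hG1
  rw [mulOp_const_one, one_mul, mul_one, ← B9Eq352DivFormLetters.conj_mul, smul_mul_smul_comm, ← pow_add, show 2 + 2 = 4 from rfl] at hGG₀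
  have hGG : HasMajorant (g := toB6 (geoCK i c) Rr Hp) (fun p : SiteY i × ι => blkCubeY i c p.1)
      (conj b (((kGeo i).eta ^ 4) • ((GpCubeY i c parS V).restrictScalars ℝ * (GpCubeY i c parS V).restrictScalars ℝ)))
      (fun a a' => (BG * BG * Λ * B6.c1 dB δ₀ (1 - 9 / 10)) * ((geoCK i c).len a ^ 2 * (geoCK i c).len a ^ 2) *
        Real.exp (-(9 / 10 * δ₀ * (geoCK i c).dist a a'))) :=
    hasMajorant_mono (g := toB6 (geoCK i c) Rr Hp) _ hGG₀ fun a a' => le_of_eq (by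
      simp only [Finset.mem_univ, if_true, one_mul, mul_zero, neg_zero, Real.exp_zero, mul_one])
  -- `conj b(η⁴X̂) ≺ κ_Q²·(…)·ℓ⁴·e^{−(9/10)δ₀d}` at the block level (FILE E2-4a's generic sandwich with the two-space majorants `hQ`, `hQs`)
  have hX := hasMajorant_conj_cube_sandwich i c b (Rr := Rr) (Hp := Hp) hκQ
    (fun a a' => mul_nonneg (mul_nonneg (mul_nonneg (mul_nonneg (mul_nonneg hBG hBG) hΛ) hc1a) (mul_nonneg (hℓ2 a) (hℓ2 a))) (Real.exp_nonneg _)) hQ hQs hGG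
  rw [← smul_XCubeY_restrictScalars] at hX
  have hX' : HasMajorant (g := toB6 (geoCK i c) Rr Hp) (fun q : BlkCubeY i c × ι => q.1)
      (conj b (((kGeo i).eta ^ 4) • (XCubeY i c parS V).restrictScalars ℝ))
      (fun a a' => ((κQ * κQ) * (BG * BG * Λ * B6.c1 dB δ₀ (1 - 9 / 10))) * ((geoCK i c).len a ^ 2 * (geoCK i c).len a ^ 2) *
        Real.exp (-(9 / 10 * δ₀ * (geoCK i c).dist a a'))) :=
    hasMajorant_mono (g := toB6 (geoCK i c) Rr Hp) _ hX fun a a' => le_of_eq (by ring)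
  -- STAGE A: the outer word `1_S·conj b(η⁴X̂)·(1 − 1_N)·conj b(η⁻⁴C)`, separation `D_N`
  have hA := sepMiddle_majorant_blk (R := Rr) (H := Hp) (fun q : BlkCubeY i c × ι => q.1) dB δ₀ (9 / 10) (1 / 10) (2 / 5) (2 / 5) 1
    ((κQ * κQ) * (BG * BG * Λ * B6.c1 dB δ₀ (1 - 9 / 10))) BC Λ DN
    (fun a => (geoCK i c).len a ^ 2 * (geoCK i c).len a ^ 2) (fun a => (geoCK i c).len a ^ (-(4 : ℝ))) (fun a => (geoCK i c).len a ^ (-(4 : ℝ)))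
    S (Finset.univ \ N) (fun q => cubeBlkInd i c S q.1) (fun q => 1 - cubeBlkInd i c N q.1)
    hκX hBC hΛ (fun a => mul_nonneg (hℓ2 a) (hℓ2 a)) hℓ4 hℓ4 hδ₀ (by norm_num) (by norm_num) (by norm_num) htri hsymm hdnn hST4 h261b
    (fun q => hind1 S q.1) (fun q hq => by rw [cubeBlkInd_apply, if_neg hq]) (fun q => hind1' N q.1)
    (fun q hq => by
      have hN : q.1 ∈ N := by by_contra h; exact hq (Finset.mem_sdiff.2 ⟨Finset.mem_univ _, h⟩)
      rw [cubeBlkInd_apply, if_pos hN, sub_self])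
    (fun a ha y hy => hDN a ha y (Finset.mem_sdiff.1 hy).2) hX' hC1
  have hA' := hasMajorant_mul_mulOp (G := toB6 (geoCK i c) Rr Hp) (fun q : BlkCubeY i c × ι => q.1) hA (fun q => cubeBlkInd i c S q.1)
    fun q => hind1 S q.1
  -- STAGE B1: the inner word `1_Š·conj b(η²G′)·(1 − χ²)·conj b(η²G′)` at the site level, separation `D_χ`
  have hB1 := sepMiddle_majorant_blk (R := Rr) (H := Hp) (fun p : SiteY i × ι => blkCubeY i c p.1) dB δ₀ 1 (1 / 10) (2 / 5) (2 / 5) 1 BG BG Λ Dχ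
    (fun a => (geoCK i c).len a ^ 2) (fun a => (geoCK i c).len a ^ 2) (fun a => (geoCK i c).len a ^ 2) S Zχ
    (fun p => cubeBlkInd i c S (blkCubeY i c p.1)) (fun p => 1 - χ p.1 * χ p.1)
    hBG hBG hΛ hℓ2 hℓ2 hℓ2 hδ₀ (by norm_num) (by norm_num) (by norm_num) htri hsymm hdnn hST2 h261b
    (fun p => hind1 S _) (fun p hp => by rw [cubeBlkInd_apply, if_neg hp])
    (fun p => by
      have h0 := hχ0 p.1; have h1 := hχ1 p.1
      rw [abs_le]; constructor <;> nlinarith [mul_nonneg h0 h0])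
    (fun p hp => by rw [hχZ p.1 hp, mul_one, sub_self]) hDχ hG1 hG1
  rw [← conj_cutMulY b (fun z : SiteY i => cubeBlkInd i c S (blkCubeY i c z)), ← conj_cutMulY b (fun z : SiteY i => 1 - χ z * χ z),
    ← B9Eq352DivFormLetters.conj_mul, ← B9Eq352DivFormLetters.conj_mul, ← B9Eq352DivFormLetters.conj_mul] at hB1
  -- STAGE B2: the `Q′_□ … Q′_□*` sandwich (FILE E2-4a)
  have hB2 := hasMajorant_conj_cube_sandwich i c b (Rr := Rr) (Hp := Hp) hκQ
    (fun a a' => mul_nonneg (mul_nonneg (mul_nonneg (by split_ifs <;> norm_num)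
      (mul_nonneg (mul_nonneg (mul_nonneg (mul_nonneg hBG hBG) hΛ) hc1b) (Real.exp_nonneg _))) (mul_nonneg (hℓ2 a) (hℓ2 a))) (Real.exp_nonneg _)) hQ hQs hB1
  have hB2' : HasMajorant (g := toB6 (geoCK i c) Rr Hp) (fun q : BlkCubeY i c × ι => q.1)
      (conj b ((QpCubeY i c parS V).restrictScalars ℝ ∘ₗ
        ((cutMulY (𝔸 := 𝔸) (fun z => cubeBlkInd i c S (blkCubeY i c z))).restrictScalars ℝ *
          (((kGeo i).eta ^ 2) • (GpCubeY i c parS V).restrictScalars ℝ) * (cutMulY (𝔸 := 𝔸) (fun z => 1 - χ z * χ z)).restrictScalars ℝ *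
          (((kGeo i).eta ^ 2) • (GpCubeY i c parS V).restrictScalars ℝ)) ∘ₗ (QpsCubeY i c parS V).restrictScalars ℝ))
      (fun a a' : (geoCK i c).Site => (κQ * κQ) *
        ((if a ∈ S then (1 : ℝ) else 0) * (BG * BG * Λ * B6.c1 dB δ₀ (1 - 2 / 5) * Real.exp (-(2 / 5 * δ₀ * Dχ))) *
          ((geoCK i c).len a ^ 2 * (geoCK i c).len a ^ 2)) * Real.exp (-(2 / 5 * δ₀ * (geoCK i c).dist a a'))) :=
    hasMajorant_mono (g := toB6 (geoCK i c) Rr Hp) _ hB2 fun a a' => le_of_eq (by simp only [mul_assoc])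
  -- STAGE B3: `1_S·(…)·1_N·conj b(η⁻⁴C)` ((2.83) with no separation)
  have hB3 := sepMiddle_majorant_blk (R := Rr) (H := Hp) (fun q : BlkCubeY i c × ι => q.1) dB δ₀ (2 / 5) (1 / 10) 0 (1 / 4) 1
    (κQ * κQ) BC Λ 0
    (fun a : (geoCK i c).Site => (if a ∈ S then (1 : ℝ) else 0) * (BG * BG * Λ * B6.c1 dB δ₀ (1 - 2 / 5) * Real.exp (-(2 / 5 * δ₀ * Dχ))) *
      ((geoCK i c).len a ^ 2 * (geoCK i c).len a ^ 2))
    (fun a => (geoCK i c).len a ^ (-(4 : ℝ))) (fun a => (geoCK i c).len a ^ (-(4 : ℝ))) S Finset.univ (fun q => cubeBlkInd i c S q.1) (fun q => cubeBlkInd i c N q.1)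
    hκQ2 hBC hΛ
    (fun a => mul_nonneg (mul_nonneg (by split_ifs <;> norm_num) (mul_nonneg (mul_nonneg (mul_nonneg (mul_nonneg hBG hBG) hΛ) hc1b) (Real.exp_nonneg _)))
      (mul_nonneg (hℓ2 a) (hℓ2 a)))
    hℓ4 hℓ4 hδ₀ le_rfl (by norm_num) (by norm_num) htri hsymm hdnn hST4 h261c
    (fun q => hind1 S q.1) (fun q hq => by rw [cubeBlkInd_apply, if_neg hq]) (fun q => hind1 N q.1) (fun _ h => absurd (Finset.mem_univ _) h)
    (fun a _ y _ => hdnn a y) hB2' hC1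
  have hB3' := hasMajorant_mul_mulOp (G := toB6 (geoCK i c) Rr Hp) (fun q : BlkCubeY i c × ι => q.1) hB3 (fun q => cubeBlkInd i c S q.1)
    fun q => hind1 S q.1
  -- the scalar bookkeeping `η⁴·η⁻⁴ = 1`, `η²·η²·η⁻⁴ = 1` matching §1's lattice-unit decomposition
  have hAeq : conj b ((XCubeY i c parS V).restrictScalars ℝ) * mulOp (fun p : BlkCubeY i c × ι => 1 - cubeBlkInd i c N p.1) *
        conj b ((XinvCubeY i c parS V).restrictScalars ℝ) =
      conj b (((kGeo i).eta ^ 4) • (XCubeY i c parS V).restrictScalars ℝ) * mulOp (fun p : BlkCubeY i c × ι => 1 - cubeBlkInd i c N p.1) *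
        conj b ((((kGeo i).eta ^ 4)⁻¹) • (XinvCubeY i c parS V).restrictScalars ℝ) := by
    rw [← conj_cutMulY b (fun s : BlkCubeY i c => 1 - cubeBlkInd i c N s), ← B9Eq352DivFormLetters.conj_mul, ← B9Eq352DivFormLetters.conj_mul,
      ← B9Eq352DivFormLetters.conj_mul, ← B9Eq352DivFormLetters.conj_mul, smul_mul_assoc, smul_mul_assoc, mul_smul_comm, smul_smul, mul_inv_cancel₀ hη4,
      one_smul]
  have hWeq : (cutMulY (𝔸 := 𝔸) (fun z => cubeBlkInd i c S (blkCubeY i c z))).restrictScalars ℝ *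
        (((kGeo i).eta ^ 2) • (GpCubeY i c parS V).restrictScalars ℝ) * (cutMulY (𝔸 := 𝔸) (fun z => 1 - χ z * χ z)).restrictScalars ℝ *
        (((kGeo i).eta ^ 2) • (GpCubeY i c parS V).restrictScalars ℝ) =
      ((kGeo i).eta ^ 4) • ((cutMulY (𝔸 := 𝔸) (fun z => cubeBlkInd i c S (blkCubeY i c z))).restrictScalars ℝ * (GpCubeY i c parS V).restrictScalars ℝ *
        (cutMulY (𝔸 := 𝔸) (fun z => 1 - χ z * χ z)).restrictScalars ℝ * (GpCubeY i c parS V).restrictScalars ℝ) := by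
    simp only [mul_smul_comm, smul_mul_assoc, smul_smul]
    congr 1
    ring
  have hBeq : conj b ((QpCubeY i c parS V).restrictScalars ℝ ∘ₗ
          ((cutMulY (𝔸 := 𝔸) (fun z => cubeBlkInd i c S (blkCubeY i c z))).restrictScalars ℝ * (GpCubeY i c parS V).restrictScalars ℝ *
            (cutMulY (𝔸 := 𝔸) (fun z => 1 - χ z * χ z)).restrictScalars ℝ * (GpCubeY i c parS V).restrictScalars ℝ) ∘ₗ
          (QpsCubeY i c parS V).restrictScalars ℝ) *
        mulOp (fun p : BlkCubeY i c × ι => cubeBlkInd i c N p.1) * conj b ((XinvCubeY i c parS V).restrictScalars ℝ) =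
      conj b ((QpCubeY i c parS V).restrictScalars ℝ ∘ₗ
          ((cutMulY (𝔸 := 𝔸) (fun z => cubeBlkInd i c S (blkCubeY i c z))).restrictScalars ℝ *
            (((kGeo i).eta ^ 2) • (GpCubeY i c parS V).restrictScalars ℝ) * (cutMulY (𝔸 := 𝔸) (fun z => 1 - χ z * χ z)).restrictScalars ℝ *
            (((kGeo i).eta ^ 2) • (GpCubeY i c parS V).restrictScalars ℝ)) ∘ₗ (QpsCubeY i c parS V).restrictScalars ℝ) *
        mulOp (fun p : BlkCubeY i c × ι => cubeBlkInd i c N p.1) * conj b ((((kGeo i).eta ^ 4)⁻¹) • (XinvCubeY i c parS V).restrictScalars ℝ) := by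
    rw [hWeq, LinearMap.smul_comp, LinearMap.comp_smul, ← conj_cutMulY b (fun s : BlkCubeY i c => cubeBlkInd i c N s), ← B9Eq352DivFormLetters.conj_mul,
      ← B9Eq352DivFormLetters.conj_mul,
      ← B9Eq352DivFormLetters.conj_mul, ← B9Eq352DivFormLetters.conj_mul, smul_mul_assoc, smul_mul_assoc, mul_smul_comm, smul_smul,
      mul_inv_cancel₀ hη4, one_smul]
  -- assembly
  rw [conj_locDefectCore_eq, hAeq, hBeq,
    show mulOp (fun p : BlkCubeY i c × ι => cubeBlkInd i c S p.1) *
          (conj b (((kGeo i).eta ^ 4) • (XCubeY i c parS V).restrictScalars ℝ) * mulOp (fun p : BlkCubeY i c × ι => 1 - cubeBlkInd i c N p.1) *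
            conj b ((((kGeo i).eta ^ 4)⁻¹) • (XinvCubeY i c parS V).restrictScalars ℝ)) *
          mulOp (fun p : BlkCubeY i c × ι => cubeBlkInd i c S p.1) =
        mulOp (fun p : BlkCubeY i c × ι => cubeBlkInd i c S p.1) * conj b (((kGeo i).eta ^ 4) • (XCubeY i c parS V).restrictScalars ℝ) *
          mulOp (fun p : BlkCubeY i c × ι => 1 - cubeBlkInd i c N p.1) * conj b ((((kGeo i).eta ^ 4)⁻¹) • (XinvCubeY i c parS V).restrictScalars ℝ) *
          mulOp (fun p : BlkCubeY i c × ι => cubeBlkInd i c S p.1) by simp only [mul_assoc]]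
  rw [show ∀ (Y C : Module.End ℝ (BlkCubeY i c × ι → ℝ)),
      mulOp (fun p : BlkCubeY i c × ι => cubeBlkInd i c S p.1) * (Y * mulOp (fun p : BlkCubeY i c × ι => cubeBlkInd i c N p.1) * C) *
          mulOp (fun p : BlkCubeY i c × ι => cubeBlkInd i c S p.1) =
        mulOp (fun p : BlkCubeY i c × ι => cubeBlkInd i c S p.1) * Y * mulOp (fun p : BlkCubeY i c × ι => cubeBlkInd i c N p.1) * C *
          mulOp (fun p : BlkCubeY i c × ι => cubeBlkInd i c S p.1) from fun Y C => by simp only [mul_assoc]]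
  refine hasMajorant_mono (g := toB6 (geoCK i c) Rr Hp) _ (hasMajorant_add (g := toB6 (geoCK i c) Rr Hp) _ hA' hB3') fun a a' => ?_
  -- the final comparison of kernels
  have hℓ := len_sq_sq_rpow_neg4 i c a
  have hexp : Real.exp (-(2 / 5 * δ₀ * (geoCK i c).dist a a')) ≤ Real.exp (-(1 / 4 * δ₀ * (geoCK i c).dist a a')) :=
    Real.exp_le_exp.2 (by nlinarith [hdnn a a'])
  have hcA : 0 ≤ (κQ * κQ) * (BG * BG * Λ * B6.c1 dB δ₀ (1 - 9 / 10)) * (BC * Λ * B6.c1 dB δ₀ (1 - 2 / 5)) * Real.exp (-(2 / 5 * δ₀ * DN)) :=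
    mul_nonneg (mul_nonneg hκX (mul_nonneg (mul_nonneg hBC hΛ) hc1b)) (Real.exp_nonneg _)
  split_ifs with ha
  · simp only [one_mul, mul_one, mul_zero, zero_mul, neg_zero, Real.exp_zero]
    calc ((κQ * κQ) * (BG * BG * Λ * B6.c1 dB δ₀ (1 - 9 / 10)) * BC * Λ * B6.c1 dB δ₀ (1 - 2 / 5) * Real.exp (-(2 / 5 * δ₀ * DN))) *
            ((geoCK i c).len a ^ 2 * (geoCK i c).len a ^ 2 * (geoCK i c).len a ^ (-(4 : ℝ))) * Real.exp (-(2 / 5 * δ₀ * (geoCK i c).dist a a')) +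
          ((κQ * κQ) * BC * Λ * B6.c1 dB δ₀ (1 - 1 / 4)) *
            ((BG * BG * Λ * B6.c1 dB δ₀ (1 - 2 / 5) * Real.exp (-(2 / 5 * δ₀ * Dχ))) * ((geoCK i c).len a ^ 2 * (geoCK i c).len a ^ 2) *
              (geoCK i c).len a ^ (-(4 : ℝ))) * Real.exp (-(1 / 4 * δ₀ * (geoCK i c).dist a a'))
        = ((κQ * κQ) * (BG * BG * Λ * B6.c1 dB δ₀ (1 - 9 / 10)) * (BC * Λ * B6.c1 dB δ₀ (1 - 2 / 5)) * Real.exp (-(2 / 5 * δ₀ * DN))) *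
              Real.exp (-(2 / 5 * δ₀ * (geoCK i c).dist a a')) * ((geoCK i c).len a ^ 2 * (geoCK i c).len a ^ 2 * (geoCK i c).len a ^ (-(4 : ℝ))) +
            ((κQ * κQ) * (BG * BG * Λ * B6.c1 dB δ₀ (1 - 2 / 5)) * (BC * Λ * B6.c1 dB δ₀ (1 - 1 / 4)) * Real.exp (-(2 / 5 * δ₀ * Dχ))) *
              Real.exp (-(1 / 4 * δ₀ * (geoCK i c).dist a a')) * ((geoCK i c).len a ^ 2 * (geoCK i c).len a ^ 2 * (geoCK i c).len a ^ (-(4 : ℝ))) := by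
          ring
      _ = ((κQ * κQ) * (BG * BG * Λ * B6.c1 dB δ₀ (1 - 9 / 10)) * (BC * Λ * B6.c1 dB δ₀ (1 - 2 / 5)) * Real.exp (-(2 / 5 * δ₀ * DN))) *
              Real.exp (-(2 / 5 * δ₀ * (geoCK i c).dist a a')) +
            ((κQ * κQ) * (BG * BG * Λ * B6.c1 dB δ₀ (1 - 2 / 5)) * (BC * Λ * B6.c1 dB δ₀ (1 - 1 / 4)) * Real.exp (-(2 / 5 * δ₀ * Dχ))) *
              Real.exp (-(1 / 4 * δ₀ * (geoCK i c).dist a a')) := by rw [hℓ, mul_one, mul_one]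
      _ ≤ ((κQ * κQ) * (BG * BG * Λ * B6.c1 dB δ₀ (1 - 9 / 10)) * (BC * Λ * B6.c1 dB δ₀ (1 - 2 / 5)) * Real.exp (-(2 / 5 * δ₀ * DN))) *
              Real.exp (-(1 / 4 * δ₀ * (geoCK i c).dist a a')) +
            ((κQ * κQ) * (BG * BG * Λ * B6.c1 dB δ₀ (1 - 2 / 5)) * (BC * Λ * B6.c1 dB δ₀ (1 - 1 / 4)) * Real.exp (-(2 / 5 * δ₀ * Dχ))) *
              Real.exp (-(1 / 4 * δ₀ * (geoCK i c).dist a a')) := by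
          gcongr
      _ = _ := by ring
  · simp only [zero_mul, mul_zero, zero_add, le_refl]

end Literature.MathematicalPhysics.QuantumFieldTheory.Balaban1983to89.B9Cor36CinvCubeLocDefectCoreHom

end
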